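import Summits.ResolutionOfSingularities.ResolutionOfSingularities.Theorems.MarkedTransferCampaignG1PnegaObligationF33StdOrdWitness
import Literature.AlgebraicGeometry.Hironaka2017.Proofs.S09LLUED.U53L4b
import Literature.RingTheory.MvPowerSeries.FrobeniusPowerBasis
import HarnessLib

/-!
# [OURS · L1 G1 ℘nega-INTERFACE] Obligation F3.3 RETYPED — Case (III) with `k̄ = 2` is UNIT-FREE WITHOUT the order clause
# (reading «II-first», R40/#case-overlap footnote; res-type-063's AVAILABLE 05:5xZ offer (b)). By res-type-063; carried by res-L1-type-o2.

CARRIER NOTE (res-L1-type-o2 g6): KERNEL by res-type-063 (HOME draft `D/res-type-063/PnegaObligationF33StdCaseIII2.draft.lean` sha16 719ff0c66ce0202d, SELF-FILE NOTICE 2026-08-27T05:53:40Z — carried instead), summit-side VERBATIM (this note added). [OURS · L1 G1] replaces the role of: nothing printed beyond what the decl docstrings cite — scoring kernels for the ORDER-repaired obligation F3.3 (Case III); NOT a statement of the manuscript.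
HONEST FRAMING. Nothing here is a statement of H. Hironaka's manuscript *Resolution of singularities in positive characteristics*
(2017-03-23, [Hironaka2017], lit key `paper:url-3343fd9e678b`; every printed item is a CANDIDATE [claim: Hironaka2017, status:
under-review]). The theorems are about the typed `H♭`-datum (`HFlatDatum`, p496649) and the typed recipe `HFlat.pre` / `HFlat.caseIII`
(row 057); they use the tree's Eq. (79) kernel (`TopDeriv.hasseDeriv_topFrontierExp`, Proofs/S09LLUED/U53L4b). AI kernel work, weaker than
expert review; nothing here is progress on resolution of singularities in positive characteristic; no claim beyond the kernel.

## The argument (Case (III) of Lem. 9.6: `0 < |α+pβ| ≤ |qγ₀| = q`, `|γ₀| = 1`; NO order clause, only §8.3's `ord ϵ(0) > q`)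
`h♭(ϵ(0)) = ∂^{(α+pβ)}ϵ(0) · ∂^{(qγ₀)}ϵ(0)` (Rem. 9.11 (1)). By Eq. (79) (`∂^{(α+pβ)}ϵ = Σ_{top block} u_j x^{qγ_j}`, tree) and
`u_j ∈ ρ^ℓ(O)` the first factor is supported on the lattice `qℕ^n` (`isSupportedOnMultiples`). The coefficient of `x^{qγ₀}` in
`h♭(ϵ(0))` is `Σ_{d₁+d₂ = qγ₀} coeff_{d₁}(∂^{(α+pβ)}ϵ(0))·coeff_{d₂}(∂^{(qγ₀)}ϵ(0))`; with `γ₀ = e_j`: `d₁ = 0` contributes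
`coeff_{α+pβ}ϵ(0)·(…) = 0` (`|α+pβ| ≤ q < ord`), `d₂ = 0` contributes `(…)·coeff_{qγ₀}ϵ(0) = 0` (`|qγ₀| = q < ord`), and `0 < d₁ < qe_j` is off
the lattice so `coeff_{d₁}` of the first factor vanishes. Hence `∂^{(qγ₀)}(h♭(ϵ(0)))` has constant term `0`, and
`H♭(ϵ(0)) = h♭(h♭(ϵ(0))) ∈ 𝔪` whenever `k̄ = 2` (i.e. `|α+pβ| > q/2`). For `k̄ ≥ 3` the question stays open (the iterate is no longer a
standard expression; the page's Rem. 9.13 / 9.16 «new standard expressions» would be needed).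
-/

noncomputable section

set_option linter.dupNamespace false -- mandated namespace of this single-conjunct summit

namespace Summit.ResolutionOfSingularities.ResolutionOfSingularities.Theorems.Campaign.PnegaObligation

open Literature.AlgebraicGeometry.Hironaka2017 Literature.AlgebraicGeometry.Hironaka2017.S09LLUED
open Literature.RingTheory.MvPowerSeries (hasseDeriv constantCoeff_hasseDeriv adicOrder_eq_order IsSupportedOnMultiples)
open Literature.RingTheory.MvPowerSeries.Jets (mem_maximalIdeal_iff_constantCoeff_eq_zero)
open MvPowerSeries (X coeff)
open IsLocalRing (maximalIdeal)

universe v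

section CaseIIITwo

variable {K' : Type v} [Field K'] {n : ℕ} {p : ℕ} [Fact p.Prime] [CharP K' p]

/-- Lattice support is inherited along divisibility of the modulus. [folklore] -/
theorem isSupportedOnMultiples_of_dvd {q q' : ℕ} (hq : q ∣ q') {ψ : MvPowerSeries (Fin n) K'} (h : IsSupportedOnMultiples q' ψ) :
    IsSupportedOnMultiples q ψ := by
  rintro m ⟨i, hi⟩
  exact h m ⟨i, fun h' => hi (dvd_trans hq h')⟩

/-- `x^{q·c}` is supported on the lattice `qℕ^n`. [folklore] -/
theorem isSupportedOnMultiples_monomial_smul (q : ℕ) (c : Fin n →₀ ℕ) :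
    IsSupportedOnMultiples q (MvPowerSeries.monomial (q • c) (1 : K')) := by
  classical
  rintro m ⟨i, hi⟩
  rw [MvPowerSeries.coeff_monomial, if_neg]
  rintro rfl
  exact hi ⟨c i, by simp⟩

/-- A finite sum of lattice-supported series is lattice-supported. [folklore] -/
theorem isSupportedOnMultiples_sum {q : ℕ} {ι : Type*} (s : Finset ι) (f : ι → MvPowerSeries (Fin n) K')
    (h : ∀ t ∈ s, IsSupportedOnMultiples q (f t)) : IsSupportedOnMultiples q (∑ t ∈ s, f t) := by
  classical
  induction s using Finset.induction_on with
  | empty => rw [Finset.sum_empty]; exact Literature.RingTheory.MvPowerSeries.isSupportedOnMultiples_zero q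
  | insert a s ha ih =>
    rw [Finset.sum_insert ha]
    exact (h a (Finset.mem_insert_self _ _)).add (ih fun t ht => h t (Finset.mem_insert_of_mem ht))

/-- **Eq. (79) ⇒ `∂^{(α+pβ)}ϵ(0)` is supported on `qℕ^n`** (`q = p^e`), for every page-shaped datum (p496649). [folklore] -/
theorem HFlatDatum.isSupportedOnMultiples_hasseDeriv_top {P : ℕ → Ideal (MvPowerSeries (Fin n) K')} (d : HFlatDatum p K' n P) :
    IsSupportedOnMultiples d.q (hasseDeriv (d.α + p • d.β) d.ε0) := by
  classical
  haveI : CharP (MvPowerSeries (Fin n) K') p :=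
    charP_of_injective_ringHom (f := (MvPowerSeries.C : K' →+* MvPowerSeries (Fin n) K')) MvPowerSeries.C_injective p
  have hle : d.e ≤ d.depth := le_of_lt (lt_trans (Nat.lt_pow_self (Fact.out : p.Prime).one_lt) d.q_lt_depth)
  have h79 := TopDeriv.hasseDeriv_topFrontierExp d.S d.e_pos hle
  change hasseDeriv (TopFrontier.topFrontierExp p d.S.support d.S.u) d.ε0 = _ at h79
  have hθ : TopFrontier.topFrontierExp p d.S.support d.S.u = d.α + p • d.β := rfl
  rw [hθ] at h79
  rw [h79]
  refine isSupportedOnMultiples_sum _ _ fun t ht => ?_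
  have hsub : t ∈ d.S.support := (TopFrontier.mem_effSupport _ _ |>.mp (TopFrontier.mem_topBlock _ _ |>.mp ht).1).1
  refine IsSupportedOnMultiples.mul ?_ (isSupportedOnMultiples_monomial_smul _ _)
  obtain ⟨f, hf⟩ := d.S.u_mem t hsub
  exact isSupportedOnMultiples_of_dvd (pow_dvd_pow p hle)
    (Literature.RingTheory.MvPowerSeries.isSupportedOnMultiples_of_exists_pow_eq p ⟨f, hf⟩)

/-- A multi-index of degree `1` is a unit vector. [folklore] -/
theorem exists_eq_single_of_degree_eq_one {γ : Fin n →₀ ℕ} (h : γ.degree = 1) : ∃ j, γ = Finsupp.single j 1 := by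
  have hne : γ ≠ 0 := fun h0 => by rw [h0, map_zero] at h; exact zero_ne_one h
  obtain ⟨j, hj⟩ := Finsupp.support_nonempty_iff.mpr hne
  refine ⟨j, ?_⟩
  have hle : Finsupp.single j 1 ≤ γ := Finsupp.single_le_iff.mpr (Nat.one_le_iff_ne_zero.mpr (Finsupp.mem_support_iff.mp hj))
  obtain ⟨c, hc⟩ := exists_add_of_le hle
  have hc0 : c.degree = 0 := by
    have := congrArg Finsupp.degree hc
    rw [map_add, Finsupp.degree_single, h] at this
    omega
  rw [(Finsupp.degree_eq_zero_iff c).mp hc0, add_zero] at hc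
  exact hc

/-- **In Case (III), `coeff_{qγ₀}(h♭(ϵ(0))) = 0`** for every page-shaped datum (no order clause; §8.3 `ord ϵ(0) > q` suffices):
the lattice argument of the module docstring. [folklore] -/
theorem HFlatDatum.coeff_pre_qγ₀_eq_zero {P : ℕ → Ideal (MvPowerSeries (Fin n) K')} (d : HFlatDatum p K' n P)
    (hIII : IsCaseIII p d.q d.α d.β d.γ₀) :
    coeff (d.q • d.γ₀) (HFlat.pre (hasseFamily K' n) p d.q d.α d.β d.γ₀ d.ε0) = 0 := by
  classical
  obtain ⟨-, hθle, hqγ, hγ1⟩ := hIII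
  obtain ⟨j, hj⟩ := exists_eq_single_of_degree_eq_one hγ1
  have hq0 : 0 < d.q := pow_pos (Fact.out : p.Prime).pos _
  have hord : ((d.q : ℕ) : ℕ∞) < d.ε0.order := by
    have h := d.std.ord_lt; rw [adicOrder_eq_order] at h; exact h
  have hsupp := d.isSupportedOnMultiples_hasseDeriv_top
  unfold HFlat.pre hasseFamily
  rw [MvPowerSeries.coeff_mul]
  refine Finset.sum_eq_zero fun x hx => ?_
  rw [Finset.HasAntidiagonal.mem_antidiagonal] at hx
  by_cases h1 : x.1 = 0
  · -- `coeff_0 (∂^{(α+pβ)}ϵ) = coeff_{α+pβ} ϵ = 0`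
    rw [h1, MvPowerSeries.coeff_zero_eq_constantCoeff_apply, constantCoeff_hasseDeriv,
      MvPowerSeries.coeff_of_lt_order (lt_of_le_of_lt (by exact_mod_cast hθle.trans (le_of_eq hqγ)) hord), zero_mul]
  by_cases h2 : x.2 = 0
  · -- `coeff_0 (∂^{(qγ₀)}ϵ) = coeff_{qγ₀} ϵ = 0`
    rw [h2, MvPowerSeries.coeff_zero_eq_constantCoeff_apply, constantCoeff_hasseDeriv,
      MvPowerSeries.coeff_of_lt_order (lt_of_le_of_lt (by exact_mod_cast (le_of_eq hqγ)) hord), mul_zero]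
  · -- `0 < x.1 j < q`: off the lattice
    have hx1 : ¬ d.q ∣ x.1 j := by
      have hsum : x.1 j + x.2 j = d.q := by
        have := DFunLike.congr_fun hx j
        simpa [hj, Finsupp.single_apply] using this
      have hx1j : x.1 j ≠ 0 := by
        intro h0
        apply h1
        ext i
        by_cases hi : i = j
        · subst hi; simpa using h0
        · have := DFunLike.congr_fun hx i
          simp [hj, hi] at this
          exact this.1
      have hx2j : x.2 j ≠ 0 := by
        intro h0
        apply h2
        ext i
        by_cases hi : i = j
        · subst hi; simpa using h0
        · have := DFunLike.congr_fun hx i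
          simp [hj, hi] at this
          exact this.2
      intro hdvd
      obtain ⟨k, hk⟩ := hdvd
      rcases k with _ | k
      · simp at hk; exact hx1j hk
      · have : d.q * (k + 1) ≥ d.q := Nat.le_mul_of_pos_right _ (Nat.succ_pos k)
        omega
    rw [hsupp x.1 ⟨j, hx1⟩, zero_mul]

/-- **Case (III) with `k̄ = 2` is UNIT-FREE without the order clause**: `H♭(ϵ(0)) = h♭(h♭(ϵ(0))) ∈ 𝔪`, since `∂^{(qγ₀)}(h♭(ϵ(0)))` has
constant term `coeff_{qγ₀}(h♭(ϵ(0))) = 0`. (`k̄ = 2` iff `|α+pβ| > q/2`; for `k̄ ≥ 3` open.) NOT a statement of the manuscript. [folklore] -/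
theorem HFlatDatum.caseIII_value_mem_maximalIdeal_of_kBar_two {P : ℕ → Ideal (MvPowerSeries (Fin n) K')}
    (d : HFlatDatum p K' n P) (hIII : IsCaseIII p d.q d.α d.β d.γ₀) (hcase : d.case = HFlat.Case.III hIII)
    (hk : HFlat.kBar d.q (HFlat.bAIII p d.q d.α d.β d.γ₀) = 2) :
    d.value ∈ maximalIdeal (MvPowerSeries (Fin n) K') := by
  unfold HFlatDatum.value
  rw [hcase]
  show HFlat.caseIII (hasseFamily K' n) p d.q d.α d.β d.γ₀ d.ε0 ∈ _
  unfold HFlat.caseIII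
  rw [hk, Function.iterate_succ_apply', Function.iterate_one]
  show HFlat.pre (hasseFamily K' n) p d.q d.α d.β d.γ₀ (HFlat.pre (hasseFamily K' n) p d.q d.α d.β d.γ₀ d.ε0) ∈ _
  show hasseDeriv (d.α + p • d.β) (HFlat.pre (hasseFamily K' n) p d.q d.α d.β d.γ₀ d.ε0) *
      hasseDeriv (d.q • d.γ₀) (HFlat.pre (hasseFamily K' n) p d.q d.α d.β d.γ₀ d.ε0) ∈ _
  refine Ideal.mul_mem_left _ _ ?_
  rw [mem_maximalIdeal_iff_constantCoeff_eq_zero, constantCoeff_hasseDeriv]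
  exact d.coeff_pre_qγ₀_eq_zero hIII

/-- **Under «II-first», every datum outside Case (III)-with-`k̄ ≥ 3` is unit-free** (no order clause): combines
`HFlatDatum.value_mem_maximalIdeal_of_selectIIFirst_of_not_caseIII` (Cases (I)/(II), `…F33StdSandwich` §4) with `k̄ = 2` above. So a UNIT
under «II-first» could only come from a Case-(III) datum with `|α+pβ| ≤ q/2` (`k̄ ≥ 3`) — none is known. [folklore] -/
theorem HFlatDatum.value_mem_maximalIdeal_of_caseIII_kBar_two {P : ℕ → Ideal (MvPowerSeries (Fin n) K')}
    (d : HFlatDatum p K' n P) (hk : ∀ hIII : IsCaseIII p d.q d.α d.β d.γ₀, d.case = HFlat.Case.III hIII →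
      HFlat.kBar d.q (HFlat.bAIII p d.q d.α d.β d.γ₀) = 2) (hIII : IsCaseIII p d.q d.α d.β d.γ₀) (hcase : d.case = HFlat.Case.III hIII) :
    d.value ∈ maximalIdeal (MvPowerSeries (Fin n) K') :=
  d.caseIII_value_mem_maximalIdeal_of_kBar_two hIII hcase (hk hIII hcase)

end CaseIIITwo

end Summit.ResolutionOfSingularities.ResolutionOfSingularities.Theorems.Campaign.PnegaObligation
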